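import Summits.AtomisticToContinuum.FouriersLaw.Theorems.LatticeLandauDampingAbelThermodynamicLimitOpenChainSeveredLocalityEstimate
import Summits.AtomisticToContinuum.FouriersLaw.Theorems.LatticeLandauDampingAbelThermodynamicLimitBulkWindowEquivalence
import Summits.AtomisticToContinuum.FouriersLaw.Theorems.JunctionLocalityNonBallisticContactCurrentFourthMoment
import Summits.AtomisticToContinuum.FouriersLaw.Theorems.JunctionLocalityNonBallisticLightConeAssemblyPart1
import Literature.MathematicalPhysics.KineticTheory.InfiniteChainDynamicsCondB1
import Mathlib.Analysis.SpecificLimits.Normed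

/-!
# Stub (M1sev) `stub_openChainSeveredLocality` of line `series-law-at-every-laplace-frequency` (crux `LatticeLandauDamping.AbelThermodynamicLimit`): `N`-uniform severed-flow `L²` locality of the open chain at fixed time

Registered stub (M1sev) of the lead's skeleton of crux stmt-AtomisticToContinuum-14013
(`Summit.AtomisticToContinuum.FouriersLaw.Theses.LatticeLandauDamping.AbelThermodynamicLimit`), proved at the end of this
file with exactly the registered signature. For the pinned anharmonic chain between Langevin baths at the sites `0` and
`N-1` (both at temperature `T`), the semigroup image `P_t j_k(z) = E_W[j_k(Φ_t(z, B))]` of a deep bond current is, in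
`L²(μ_{N,T})` and uniformly in the length `N`, the depth of the bond and `t ≤ τ`, close to the DETERMINISTIC local
functional `j_k ∘ T^Λ_t ∘ ι` — LLL's severed flow of the window `Λ = [k-M, k+1+M]` (particles off `Λ` frozen) applied to
the configuration embedded in `ℤ → ℝ × ℝ` — as soon as `M ≥ M₀(ε, τ)`.

Proof. Jensen in the noise (`transitionKernel = law of solMap`) reduces the claim to the fixed-scale estimate
`pinnedChain_openChain_severed_estimate` (`…OpenChainSeveredLocalityEstimate`: weighted position box of the strong
solution `pinnedChain_weightedBox_exceptionalSet`, exceptional set along the severed flow, pathwise Dobrushin–Fritz core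
`pinnedChain_openChain_severed_pathwise`, invariance of the embedded free Gibbs state under the severed flow, `N`-uniform
fourth moments of the currents), whose bound `(cone term)(M, ρ) + 4√(C₄(K + 4^{17}C_pτ^{32})/ρ^{32})` is made `≤ ε` by
first choosing the scale `ρ = ρ(ε, τ)` (bad term `≤ ε/2`) and then `M₀` (the cone term is `O((3+M)⁵ 4^{-M})` and the
light-cone regime `2e√Θ τ ≤ 2M+1` holds for large `M`, since `Θ = O(3+M)`). Folklore; no definitions.
-/

noncomputable section

open MeasureTheory ProbabilityTheory Set Filter Topology
open scoped NNReal ENNReal BigOperators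

namespace Summit.AtomisticToContinuum.FouriersLaw.Theorems.AbelThermodynamicLimit.SeriesLawAtEveryLaplaceFrequency

open Literature.MathematicalPhysics.KineticTheory Literature.MathematicalPhysics.KineticTheory.HeatConduction
open Literature.Probability.Process OscillatorChain BulkWindow
open Summit.AtomisticToContinuum.FouriersLaw.Theorems.NonBallistic

namespace SeveredLocality

variable {N : ℕ} {ω₂ lam β γ : ℝ}

/-! ### Jensen in the noise -/

section Jensen

variable (hω : 0 < ω₂) (hl : 0 < lam) (hβ : 0 < β) (hγ : 0 < γ) (hN : 0 < N) {T : ℝ} (hT : 0 < T)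
include hω hl hβ hγ hN hT

/-- Pointwise Jensen: `(κ_s j_k(x) − c)² ≤ ∫ (j_k(Φ_s(x, Bω)) − c)² dW(ω)` in Lebesgue form. [folklore] -/
theorem ofReal_sq_kernel_sub_const_le (k : Fin N) (s : ℝ≥0) (x : PhaseSpace N) (c : ℝ) :
    ENNReal.ofReal (((∫ y, (pinnedChain ω₂ lam β γ).bondCurrent N k y
        ∂((pinnedChain ω₂ lam β γ).transitionKernel N T T s x)) - c) ^ 2) ≤
      ∫⁻ ω, ENNReal.ofReal (((pinnedChain ω₂ lam β γ).bondCurrent N k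
        ((pinnedChain ω₂ lam β γ).solMap N T T s x (pairPath ω)) - c) ^ 2) ∂wienerPair := by
  -- adapted from `NonBallistic.FSAssembly.sq_kernel_sub_le_integral_sq`
  set P := pinnedChain ω₂ lam β γ with hP
  have hcont : Continuous (P.bondCurrent N k) := pinnedChain_continuous_bondCurrent ω₂ lam β γ N k
  obtain ⟨h1, h1sq⟩ := FSAssembly.integrable_bondCurrent_solMap hω hl.le hβ hγ hN hT k s x
  rw [pinnedChain_integral_transitionKernel hω hl.le hβ.le hγ.le N T T s x hcont.aestronglyMeasurable]
  haveI : IsProbabilityMeasure wienerPair := by infer_instance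
  have hsub : (∫ ω, P.bondCurrent N k (P.solMap N T T s x (pairPath ω)) ∂wienerPair) - c =
      ∫ ω, (P.bondCurrent N k (P.solMap N T T s x (pairPath ω)) - c) ∂wienerPair := by
    rw [integral_sub h1 (integrable_const c), integral_const, smul_eq_mul, probReal_univ, one_mul]
  rw [hsub]
  have h2 : Integrable (fun ω => (P.bondCurrent N k (P.solMap N T T s x (pairPath ω)) - c) ^ 2) wienerPair := by
    have hm : AEStronglyMeasurable (fun ω => (P.bondCurrent N k (P.solMap N T T s x (pairPath ω)) - c) ^ 2) wienerPair :=
      ((h1.sub (integrable_const c)).aestronglyMeasurable.aemeasurable.pow_const 2).aestronglyMeasurable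
    refine Integrable.mono' ((h1sq.const_mul 2).add (integrable_const (2 * c ^ 2))) hm (ae_of_all _ fun ω => ?_)
    rw [Real.norm_eq_abs, abs_of_nonneg (sq_nonneg _)]
    simp only [Pi.add_apply]
    have e : ∀ a : ℝ, (a - c) ^ 2 ≤ 2 * a ^ 2 + 2 * c ^ 2 := fun a => by
      linarith [sq_nonneg (a + c), show 2 * a ^ 2 + 2 * c ^ 2 - (a - c) ^ 2 = (a + c) ^ 2 by ring]
    exact e _
  exact (ENNReal.ofReal_le_ofReal (ProfileAntitone.sq_integral_le_integral_sq (h1.sub (integrable_const c)) h2)).trans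
    (ProfileAntitone.ofReal_integral_le_lintegral_ofReal' (ae_of_all _ fun _ => sq_nonneg _))

/-- **From the pathwise mean square to the kernel level.** If `c` is measurable, `B ≥ 0`, `t ≥ 0` and
`∫⁻ z, ∫⁻ ω, (j_k(Φ_t(z,Bω)) − c(z))² dW dμ_{N,T} ≤ B`, then `z ↦ (P_t j_k(z) − c(z))²` is `μ_{N,T}`-integrable with
integral `≤ B`. [folklore] -/
theorem integrable_sq_kernel_sub_of_lintegral (k : Fin N) {t : ℝ} (ht : 0 ≤ t) {c : PhaseSpace N → ℝ}
    (hc : Measurable c) {B : ℝ} (hB : 0 ≤ B)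
    (h : ∫⁻ z, ∫⁻ ω, ENNReal.ofReal (((pinnedChain ω₂ lam β γ).bondCurrent N k
        ((pinnedChain ω₂ lam β γ).solMap N T T t z (pairPath ω)) - c z) ^ 2) ∂wienerPair
        ∂((pinnedChain ω₂ lam β γ).gibbsMeasure N T) ≤ ENNReal.ofReal B) :
    Integrable (fun z => ((∫ y, (pinnedChain ω₂ lam β γ).bondCurrent N k y
        ∂((pinnedChain ω₂ lam β γ).transitionKernel N T T t.toNNReal z)) - c z) ^ 2)
        ((pinnedChain ω₂ lam β γ).gibbsMeasure N T) ∧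
      ∫ z, ((∫ y, (pinnedChain ω₂ lam β γ).bondCurrent N k y
        ∂((pinnedChain ω₂ lam β γ).transitionKernel N T T t.toNNReal z)) - c z) ^ 2
        ∂((pinnedChain ω₂ lam β γ).gibbsMeasure N T) ≤ B := by
  set P := pinnedChain ω₂ lam β γ with hP
  set μ := P.gibbsMeasure N T with hμ
  set κ := P.transitionKernel N T T t.toNNReal with hκ
  set G : PhaseSpace N → ℝ := fun z => ((∫ y, P.bondCurrent N k y ∂(κ z)) - c z) ^ 2 with hG
  have hG0 : ∀ z, 0 ≤ G z := fun z => sq_nonneg _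
  have hjm : Measurable (P.bondCurrent N k) := (pinnedChain_continuous_bondCurrent ω₂ lam β γ N k).measurable
  haveI : IsMarkovKernel κ := pinnedChain_isMarkovKernel_transitionKernel hω hl.le hβ.le hγ.le N T T _
  have hIm : StronglyMeasurable fun z => ∫ y, P.bondCurrent N k y ∂(κ z) :=
    (hjm.stronglyMeasurable.comp_measurable measurable_snd).integral_kernel_prod_right'
  have hGm : Measurable G := (hIm.measurable.sub hc).pow_const 2
  have et : ((t.toNNReal : ℝ≥0) : ℝ) = t := Real.coe_toNNReal t ht
  have hpt : ∀ z, ENNReal.ofReal (G z) ≤ ∫⁻ ω, ENNReal.ofReal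
      ((P.bondCurrent N k (P.solMap N T T t z (pairPath ω)) - c z) ^ 2) ∂wienerPair := by
    intro z
    have h1 := ofReal_sq_kernel_sub_const_le hω hl hβ hγ hN hT k t.toNNReal z (c z)
    rwa [et] at h1
  have hlin : ∫⁻ z, ENNReal.ofReal (G z) ∂μ ≤ ENNReal.ofReal B := (lintegral_mono hpt).trans h
  have hint : Integrable G μ := by
    refine ⟨hGm.aestronglyMeasurable, ?_⟩
    rw [HasFiniteIntegral]
    calc ∫⁻ z, ‖G z‖ₑ ∂μ = ∫⁻ z, ENNReal.ofReal (G z) ∂μ := lintegral_congr fun z => Real.enorm_eq_ofReal (hG0 z)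
      _ < ∞ := hlin.trans_lt ENNReal.ofReal_lt_top
  refine ⟨hint, (ENNReal.ofReal_le_ofReal_iff hB).1 ?_⟩
  rw [ofReal_integral_eq_lintegral_ofReal hint (ae_of_all _ hG0)]
  exact hlin

end Jensen

/-! ### Choice of the scale and of the depth -/

section Main

variable (hω : 0 < ω₂) (hl : 0 < lam) (hβ : 0 < β) (hγ : 0 < γ) {T : ℝ} (hT : 0 < T)
  (hB1 : (pinnedChain ω₂ lam β γ).CondB1)

include hω hl hβ hT in
/-- Growth of the cone constant: `Θ(M) ≤ A₀ (3+M)` and `cone(M) ≤ K₀ (3+M)⁵/4^M`. [folklore] -/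
theorem cone_le (ρ : ℝ) (M : ℕ) :
    ω₂ + 3 * lam * (3 * ρ ^ 2 * Real.sqrt (3 + (M : ℝ))) + 4 * (1 + 12 * β * (3 * ρ ^ 2 * Real.sqrt (3 + (M : ℝ)))) ≤
        (ω₂ + 4 + (3 * lam + 48 * β) * (3 * ρ ^ 2)) * (3 + (M : ℝ)) ∧
      (32 * (1 + 4 * β) ^ 2 + 8 * T * (1 + 12 * β) ^ 2) * (3 * ρ ^ 2 * Real.sqrt (3 + (M : ℝ))) ^ 4 *
          (ω₂ + 3 * lam * (3 * ρ ^ 2 * Real.sqrt (3 + (M : ℝ))) +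
            4 * (1 + 12 * β * (3 * ρ ^ 2 * Real.sqrt (3 + (M : ℝ))))) / 4 ^ (2 * M + 1) ≤
        ((32 * (1 + 4 * β) ^ 2 + 8 * T * (1 + 12 * β) ^ 2) * (3 * ρ ^ 2) ^ 4 *
          (ω₂ + 4 + (3 * lam + 48 * β) * (3 * ρ ^ 2))) * ((3 + (M : ℝ)) ^ 5 / 4 ^ M) := by
  have hM : (1 : ℝ) ≤ 3 + M := by linarith [M.cast_nonneg (α := ℝ)]
  have hsq : Real.sqrt (3 + (M : ℝ)) ≤ 3 + M := by
    rw [Real.sqrt_le_iff]; exact ⟨by linarith, by nlinarith⟩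
  set X : ℝ := 3 * ρ ^ 2 * Real.sqrt (3 + (M : ℝ)) with hX
  have hX0 : 0 ≤ X := by positivity
  have hXle : X ≤ 3 * ρ ^ 2 * (3 + M) := mul_le_mul_of_nonneg_left hsq (by positivity)
  set A₀ : ℝ := ω₂ + 4 + (3 * lam + 48 * β) * (3 * ρ ^ 2) with hA₀
  have hΘ : ω₂ + 3 * lam * X + 4 * (1 + 12 * β * X) ≤ A₀ * (3 + M) := by
    have e : ω₂ + 3 * lam * X + 4 * (1 + 12 * β * X) = (ω₂ + 4) + (3 * lam + 48 * β) * X := by ring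
    have h1 : (3 * lam + 48 * β) * X ≤ (3 * lam + 48 * β) * (3 * ρ ^ 2 * (3 + M)) :=
      mul_le_mul_of_nonneg_left hXle (by positivity)
    have h2 : ω₂ + 4 ≤ (ω₂ + 4) * (3 + M) := le_mul_of_one_le_right (by positivity) hM
    rw [e, hA₀]; linarith
  refine ⟨hΘ, ?_⟩
  have hΘ0 : 0 ≤ ω₂ + 3 * lam * X + 4 * (1 + 12 * β * X) := by positivity
  have hpow : X ^ 4 ≤ (3 * ρ ^ 2 * (3 + M)) ^ 4 := pow_le_pow_left₀ hX0 hXle 4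
  have h4 : (1 : ℝ) / 4 ^ (2 * M + 1) ≤ 1 / 4 ^ M :=
    one_div_le_one_div_of_le (by positivity) (pow_le_pow_right₀ (by norm_num) (by omega))
  set C : ℝ := 32 * (1 + 4 * β) ^ 2 + 8 * T * (1 + 12 * β) ^ 2 with hC
  calc C * X ^ 4 * (ω₂ + 3 * lam * X + 4 * (1 + 12 * β * X)) / 4 ^ (2 * M + 1)
      = C * (X ^ 4 * (ω₂ + 3 * lam * X + 4 * (1 + 12 * β * X))) * (1 / 4 ^ (2 * M + 1)) := by ring
    _ ≤ C * ((3 * ρ ^ 2 * (3 + M)) ^ 4 * (A₀ * (3 + M))) * (1 / 4 ^ M) := by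
        gcongr
    _ = C * (3 * ρ ^ 2) ^ 4 * A₀ * ((3 + (M : ℝ)) ^ 5 / 4 ^ M) := by ring

include hω hl hβ hγ hT in
/-- **The main lemma**: for every horizon `τ > 0` and `ε > 0` there is a depth `M₀` such that for all `M ≥ M₀`, every
length, every embedding of the chain along `{0,…,N-1}`, every deep bond `(k, k+1)` and every `t ≤ τ`, the pathwise mean
square of `j_k(Φ_t(z,Bω)) − j_k(T^Λ_t ι z)` under `μ_{N,T} ⊗ W` is `≤ ε`. [folklore] -/
theorem severed_locality_main {τ : ℝ} (hτ : 0 < τ) {ε : ℝ} (hε : 0 < ε) :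
    ∃ M₀ : ℕ, ∀ M : ℕ, M₀ ≤ M → ∀ (N : ℕ) (e : Fin N ≃ ↥(Finset.Icc (0 : ℤ) (0 + N - 1))),
      (∀ k : Fin N, ((e k : ↥(Finset.Icc (0 : ℤ) (0 + N - 1))) : ℤ) = 0 + k) → ∀ (η₀ : ChainConfig) (k : Fin N),
      M + 2 ≤ k.val → k.val + M + 3 < N → ∀ t ∈ Set.Icc (0:ℝ) τ,
      ∫⁻ z, ∫⁻ ω, ENNReal.ofReal
          (((pinnedChain ω₂ lam β γ).bondCurrent N k ((pinnedChain ω₂ lam β γ).solMap N T T t z (pairPath ω)) -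
            (pinnedChain ω₂ lam β γ).bondCurrentZ
              (severedFlow hB1 (Finset.Icc ((k.val : ℤ) - M) ((k.val : ℤ) + 1 + M)) t
                (embed (Finset.Icc (0 : ℤ) (0 + N - 1)) e η₀ z)) (k.val : ℤ)) ^ 2)
          ∂wienerPair ∂((pinnedChain ω₂ lam β γ).gibbsMeasure N T) ≤ ENNReal.ofReal ε := by
  obtain ⟨K, hK0, hK⟩ := pinnedChain_weightedBox_exceptionalSet ω₂ lam β γ hω hl.le hβ.le hγ.le T hT τ hτ
  obtain ⟨C₄, hC₄0, hC₄⟩ := pinnedChain_contactCurrentFourthMoment ω₂ lam β γ hω hl.le hβ.le T hT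
  have hCp0 : 0 ≤ T ^ 16 * ∏ j ∈ Finset.range 16, (2 * (j : ℝ) + 1) :=
    mul_nonneg (pow_nonneg hT.le _) (Finset.prod_nonneg fun j _ => by positivity)
  -- the scale
  obtain ⟨Q, hQ⟩ : ∃ Q : ℝ, Q = C₄ * (K + 4 ^ 16 * (T ^ 16 * ∏ j ∈ Finset.range 16, (2 * (j : ℝ) + 1)) * τ ^ 32 * 4) :=
    ⟨_, rfl⟩
  have hQ0 : 0 ≤ Q := by rw [hQ]; positivity
  obtain ⟨ρ, hρ⟩ : ∃ ρ : ℝ, ρ = max 1 (64 * Q / ε ^ 2) := ⟨_, rfl⟩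
  have hρ1 : 1 ≤ ρ := by rw [hρ]; exact le_max_left _ _
  have hρ0 : 0 < ρ := lt_of_lt_of_le one_pos hρ1
  have hbad : 4 * Real.sqrt (C₄ * (K / ρ ^ 32 +
      4 ^ 16 * (T ^ 16 * ∏ j ∈ Finset.range 16, (2 * (j : ℝ) + 1)) * τ ^ 32 / ρ ^ 32 * 4)) ≤ ε / 2 := by
    have hρQ : 64 * Q / ε ^ 2 ≤ ρ ^ 32 :=
      ((le_max_right _ _).trans_eq hρ.symm).trans (le_self_pow₀ hρ1 (by norm_num))
    have e1 : C₄ * (K / ρ ^ 32 + 4 ^ 16 * (T ^ 16 * ∏ j ∈ Finset.range 16, (2 * (j : ℝ) + 1)) * τ ^ 32 / ρ ^ 32 * 4) =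
        Q / ρ ^ 32 := by
      rw [hQ]; field_simp
    rw [e1]
    have h64 : 64 * Q ≤ ρ ^ 32 * ε ^ 2 := (div_le_iff₀ (by positivity)).1 hρQ
    have hq : Q / ρ ^ 32 ≤ (ε / 8) ^ 2 := by
      rw [div_le_iff₀ (by positivity)]; nlinarith [h64]
    calc 4 * Real.sqrt (Q / ρ ^ 32) ≤ 4 * Real.sqrt ((ε / 8) ^ 2) := by gcongr
      _ = ε / 2 := by rw [Real.sqrt_sq (by positivity)]; ring
  -- the depth
  obtain ⟨A₀, hA₀⟩ : ∃ A₀ : ℝ, A₀ = ω₂ + 4 + (3 * lam + 48 * β) * (3 * ρ ^ 2) := ⟨_, rfl⟩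
  have hA₀0 : 0 ≤ A₀ := by rw [hA₀]; positivity
  obtain ⟨K₀, hK₀⟩ : ∃ K₀ : ℝ, K₀ = (32 * (1 + 4 * β) ^ 2 + 8 * T * (1 + 12 * β) ^ 2) * (3 * ρ ^ 2) ^ 4 * A₀ :=
    ⟨_, rfl⟩
  have hlim : Tendsto (fun M : ℕ => K₀ * ((3 + (M : ℝ)) ^ 5 / 4 ^ M)) atTop (𝓝 0) := by
    have h1 : Tendsto (fun n : ℕ => (n : ℝ) ^ 5 / 4 ^ n) atTop (𝓝 0) :=
      tendsto_pow_const_div_const_pow_of_one_lt 5 (by norm_num)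
    have h2 := (h1.comp (tendsto_add_atTop_nat 3)).const_mul (K₀ * 64)
    rw [mul_zero] at h2
    refine h2.congr fun M => ?_
    simp only [Function.comp_apply]
    push_cast
    rw [pow_add]; field_simp; ring
  obtain ⟨M₁, hM₁⟩ := eventually_atTop.1 (hlim.eventually (gt_mem_nhds (half_pos hε)))
  refine ⟨max M₁ (max 3 ⌈(2 * Real.exp 1 * τ) ^ 2 * A₀⌉₊), fun M hM N e he η₀ k hk hkN t ht => ?_⟩
  have hMM₁ : M₁ ≤ M := le_trans (le_max_left _ _) hM
  have hM3 : (3 : ℝ) ≤ M := by exact_mod_cast le_trans (le_max_left 3 _) (le_trans (le_max_right _ _) hM)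
  have hMc : (2 * Real.exp 1 * τ) ^ 2 * A₀ ≤ M :=
    le_trans (Nat.le_ceil _) (by exact_mod_cast le_trans (le_max_right 3 _) (le_trans (le_max_right _ _) hM))
  obtain ⟨hΘle, hcone⟩ := cone_le hω hl hβ hT ρ M
  rw [← hA₀] at hΘle hcone
  rw [← hK₀] at hcone
  -- the regime
  have hreg : 2 * Real.exp 1 * (Real.sqrt (ω₂ + 3 * lam * (3 * ρ ^ 2 * Real.sqrt (3 + (M : ℝ))) +
      4 * (1 + 12 * β * (3 * ρ ^ 2 * Real.sqrt (3 + (M : ℝ))))) * τ) ≤ 2 * M + 1 := by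
    set Θ := ω₂ + 3 * lam * (3 * ρ ^ 2 * Real.sqrt (3 + (M : ℝ))) +
      4 * (1 + 12 * β * (3 * ρ ^ 2 * Real.sqrt (3 + (M : ℝ)))) with hΘ
    have hΘ0 : 0 ≤ Θ := by positivity
    have hsq : (2 * Real.exp 1 * (Real.sqrt Θ * τ)) ^ 2 ≤ ((2 * M + 1 : ℝ)) ^ 2 :=
      calc (2 * Real.exp 1 * (Real.sqrt Θ * τ)) ^ 2 = (2 * Real.exp 1 * τ) ^ 2 * Real.sqrt Θ ^ 2 := by ring
        _ = (2 * Real.exp 1 * τ) ^ 2 * Θ := by rw [Real.sq_sqrt hΘ0]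
        _ ≤ (2 * Real.exp 1 * τ) ^ 2 * (A₀ * (3 + M)) := mul_le_mul_of_nonneg_left hΘle (sq_nonneg _)
        _ = (2 * Real.exp 1 * τ) ^ 2 * A₀ * (3 + M) := by ring
        _ ≤ M * (2 * M + 1) := mul_le_mul hMc (by linarith) (by positivity) (M.cast_nonneg)
        _ ≤ (2 * M + 1 : ℝ) ^ 2 := by nlinarith [M.cast_nonneg (α := ℝ)]
    exact (pow_le_pow_iff_left₀ (by positivity) (by positivity) two_ne_zero).1 hsq
  -- the fixed-scale estimate
  obtain ⟨E, hEm, hEπ, hbox⟩ := hK N k ρ hρ1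
  have hest := severed_estimate hω hl hβ hγ hT hB1 e he η₀ k hk hkN hρ1 hτ hreg E hEm
    (by positivity : 0 ≤ K / ρ ^ 32) hEπ hbox hC₄0 (hC₄ N k) ht
  refine hest.trans ?_
  have h1 := hcone.trans (hM₁ M hMM₁).le
  have hc0 : 0 ≤ (32 * (1 + 4 * β) ^ 2 + 8 * T * (1 + 12 * β) ^ 2) * (3 * ρ ^ 2 * Real.sqrt (3 + (M : ℝ))) ^ 4 *
      (ω₂ + 3 * lam * (3 * ρ ^ 2 * Real.sqrt (3 + (M : ℝ))) +
        4 * (1 + 12 * β * (3 * ρ ^ 2 * Real.sqrt (3 + (M : ℝ))))) / 4 ^ (2 * M + 1) := by positivity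
  calc _ ≤ ENNReal.ofReal (ε / 2) + ENNReal.ofReal (ε / 2) :=
        add_le_add (ENNReal.ofReal_le_ofReal h1) (ENNReal.ofReal_le_ofReal hbad)
    _ = ENNReal.ofReal ε := by rw [← ENNReal.ofReal_add (by positivity) (by positivity), add_halves]

end Main

end SeveredLocality

open SeveredLocality in
/-- **Stub (M1sev) `stub_openChainSeveredLocality`** of the line `series-law-at-every-laplace-frequency` (crux
`LatticeLandauDamping.AbelThermodynamicLimit`), with exactly the registered signature: `N`-uniform severed-flow `L²`
locality of the OPEN pinned anharmonic chain at fixed time — for `T > 0`, a horizon `τ > 0` and `ε > 0` there is a depth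
`M₀` such that for every `M ≥ M₀`, every length `N`, every bond `(k, k+1)` with `M + 2 ≤ k`, `k + M + 3 < N` and every
`t ∈ [0, τ]`, the squared difference between the semigroup image `P_t j_k(z)` of the bond current and the current of LLL's
severed flow of the window `[k-M, k+1+M]` applied for time `t` to the configuration `z` embedded in `ℤ → ℝ × ℝ` (zero
outside the chain) is `μ_{N,T}`-integrable with integral `≤ ε` (Jensen in the noise + `severed_locality_main`).
[folklore] -/
theorem stub_openChainSeveredLocality :
    ∀ ω₂ lam β γ : ℝ, ∀ (hω : 0 < ω₂) (hl : 0 < lam) (hβ : 0 < β), 0 < γ → ∀ T : ℝ, 0 < T →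
      ∀ τ : ℝ, 0 < τ → ∀ ε : ℝ, 0 < ε → ∃ M₀ : ℕ, ∀ M : ℕ, M₀ ≤ M → ∃ N₀ : ℕ, ∀ N : ℕ, N₀ ≤ N →
        ∀ (k : Fin N) (hk : M + 2 ≤ k.val) (hkN : k.val + M + 3 < N), ∀ t ∈ Set.Icc (0 : ℝ) τ,
          MeasureTheory.Integrable (fun z : Literature.MathematicalPhysics.KineticTheory.HeatConduction.PhaseSpace N =>
              ((∫ y, (Literature.MathematicalPhysics.KineticTheory.HeatConduction.pinnedChain ω₂ lam β γ).bondCurrent N k y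
                  ∂((Literature.MathematicalPhysics.KineticTheory.HeatConduction.pinnedChain ω₂ lam β γ).transitionKernel N T T t.toNNReal z)) -
                (Literature.MathematicalPhysics.KineticTheory.HeatConduction.pinnedChain ω₂ lam β γ).bondCurrentZ
                  (Literature.MathematicalPhysics.KineticTheory.HeatConduction.OscillatorChain.severedFlow
                    (Literature.MathematicalPhysics.KineticTheory.HeatConduction.OscillatorChain.condB1_pinnedChain hω.le hl.le hβ.le γ)
                    (Finset.Icc ((k.val : ℤ) - M) ((k.val : ℤ) + 1 + M)) t
                    (fun x : ℤ => if h : 0 ≤ x ∧ x < N then (z.1 ⟨x.toNat, by omega⟩, z.2 ⟨x.toNat, by omega⟩) else (0, 0)))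
                  (k.val : ℤ)) ^ 2)
            ((Literature.MathematicalPhysics.KineticTheory.HeatConduction.pinnedChain ω₂ lam β γ).gibbsMeasure N T) ∧
          ∫ z : Literature.MathematicalPhysics.KineticTheory.HeatConduction.PhaseSpace N,
              ((∫ y, (Literature.MathematicalPhysics.KineticTheory.HeatConduction.pinnedChain ω₂ lam β γ).bondCurrent N k y
                  ∂((Literature.MathematicalPhysics.KineticTheory.HeatConduction.pinnedChain ω₂ lam β γ).transitionKernel N T T t.toNNReal z)) -
                (Literature.MathematicalPhysics.KineticTheory.HeatConduction.pinnedChain ω₂ lam β γ).bondCurrentZ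
                  (Literature.MathematicalPhysics.KineticTheory.HeatConduction.OscillatorChain.severedFlow
                    (Literature.MathematicalPhysics.KineticTheory.HeatConduction.OscillatorChain.condB1_pinnedChain hω.le hl.le hβ.le γ)
                    (Finset.Icc ((k.val : ℤ) - M) ((k.val : ℤ) + 1 + M)) t
                    (fun x : ℤ => if h : 0 ≤ x ∧ x < N then (z.1 ⟨x.toNat, by omega⟩, z.2 ⟨x.toNat, by omega⟩) else (0, 0)))
                  (k.val : ℤ)) ^ 2
            ∂((Literature.MathematicalPhysics.KineticTheory.HeatConduction.pinnedChain ω₂ lam β γ).gibbsMeasure N T) ≤ ε := by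
  intro ω₂ lam β γ hω hl hβ hγ T hT τ hτ ε hε
  obtain ⟨M₀, hM₀⟩ := severed_locality_main hω hl hβ hγ hT
    (Literature.MathematicalPhysics.KineticTheory.HeatConduction.OscillatorChain.condB1_pinnedChain hω.le hl.le hβ.le γ)
    hτ hε
  refine ⟨M₀, fun M hM => ⟨0, fun N _ k hk hkN t ht => ?_⟩⟩
  have hN : 0 < N := k.pos
  obtain ⟨e, he⟩ := exists_equiv_Icc (0 : ℤ) N
  have hmain := hM₀ M hM N e he (fun _ => ((0 : ℝ), (0 : ℝ))) k hk hkN t ht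
  have hcm : Measurable fun z : PhaseSpace N => (pinnedChain ω₂ lam β γ).bondCurrentZ
      (severedFlow (condB1_pinnedChain hω.le hl.le hβ.le γ) (Finset.Icc ((k.val : ℤ) - M) ((k.val : ℤ) + 1 + M)) t
        (embed (Finset.Icc (0 : ℤ) (0 + N - 1)) e (fun _ => ((0 : ℝ), (0 : ℝ))) z)) (k.val : ℤ) :=
    (measurable_bondCurrentZ _ _).comp (measurable_severedFlow_embed γ _ e _ _ t)
  have hres := integrable_sq_kernel_sub_of_lintegral hω hl hβ hγ hN hT k ht.1 hcm hε.le hmain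
  rw [embed_Icc_zero_eq_dite e he] at hres
  exact hres

end Summit.AtomisticToContinuum.FouriersLaw.Theorems.AbelThermodynamicLimit.SeriesLawAtEveryLaplaceFrequency

end
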